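import Literature.AlgebraicGeometry.Motives.FamiliesVHSTensorPower
import Literature.AlgebraicGeometry.Motives.FamiliesVHSTateTwist
import Literature.AlgebraicGeometry.Motives.FamiliesVHSProd
import Literature.AlgebraicGeometry.Motives.FamiliesVHSLevelStructureUnipotentMonodromy
import Literature.LinearAlgebra.UnipotentLogarithmTensorProduct
import HarnessLib

/-!
# Unipotent and quasi-unipotent monodromy, and «monodromy trivial mod `k`», are inherited by the tensor constructions of VHS data
# (`⊗`, `∨`, `Hom`, `⊕`, Tate twists, tensor powers, `T^{a,b}`): one finite étale cover makes the local monodromy of all of them unipotent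

Topic `Literature/AlgebraicGeometry/Motives` (namespaces `Literature.AlgebraicGeometry.Motives` (§1–§2, linear algebra), `….LocalSystem` (§3),
`….VHSData` (§4–§5)), lane `lit-hodgefound` (seat `p08`, row g57-#10).  THEOREMS ONLY (no definition, no named fact, no instance, no notation;
D-0026 net debt `0`).  Sequel of `Motives/FamiliesVHSLevelStructureUnipotentMonodromy` (CDK's «the assumption on the monodromy ensures that the
local monodromy of `𝒱` at infinity is unipotent» for ONE variation) and of the `⊗`-toolkit `Motives/FamiliesVHSTensor ∕ Dual ∕ Hom ∕ Prod ∕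
TateTwist ∕ TensorPower`.

PRINTED SOURCES.  E. Cattani, P. Deligne, A. Kaplan, *On the locus of Hodge classes*, J. AMS 8 (1995), «Proof of 1.5 ⟹ 1.1» (p. 485): «We may
and shall assume that the monodromy mod `k` of `𝒱` is trivial, for some `k ≥ 3`. … The assumption on the monodromy ensures that the local monodromy
of `𝒱` at infinity is unipotent» — applied in the literature to the tensor constructions `T^{a,b}𝒱` of a fixed `𝒱` (the Hodge loci of all of
them are controlled on the SAME cover).  A. Borel, *Linear algebraic groups*, I.4 (Jordan decomposition: products of commuting unipotent
endomorphisms are unipotent; 4.4).  W. Schmid, *Variation of Hodge structure*, Invent. Math. 22 (1973), §4 (quasi-unipotence of the monodromy, (4.5)).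
P. Deligne, *Équations différentielles à points singuliers réguliers*, LNM 163 (1970), I.1 (the monodromy of `V₁ ⊗ V₂`, `V^∨`, `V₁ ⊕ V₂` is
`T₁ ⊗ T₂`, `(T^{-1})^∨`, `T₁ ⊕ T₂`).

* §1 RINGS (the tree's `Literature/LinearAlgebra/MultiplicativeJordanDecomposition` has products and powers of unipotents; added here): `(ab)^{mn} − 1`
  from `a^m − 1`, `b^n − 1` for commuting `a, b` (quasi-unipotents), and `b − 1` from `a − 1` when `ab = ba = 1`.
* §2 LINEAR MAPS over a commutative ring (the tree's `Literature/LinearAlgebra/UnipotentLogarithmTensorProduct` has `T₁ ⊗ T₂ − 1` and `T^∨ − 1`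
  nilpotent from `Tᵢ − 1`; REUSED): the quasi-unipotent forms (`isNilpotent_map_pow_sub_one`, `isNilpotent_dualMap_pow_sub_one`), `T₁ ⊕ T₂ − 1`
  over a commutative ring (`isNilpotent_prodMap_sub_one`; the tree's `Literature.LinearAlgebra.isNilpotent_prodMap_sub_one` is over a field) and
  «`≡ 1 (mod c)`» (`∀ u, ∃ u', T u − u = c·u'`) inherited by `T₁ ⊗ T₂`, `T₁ ⊕ T₂` and — on a free module, where it means `T − 1 = c·B`
  (`exists_sub_one_eq_smul_of_forall`) — by `T^∨`; all also for `c : ℕ` (`…_nsmul`).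
* §3 LOCAL SYSTEMS: along a loop, unipotence ∕ level of the transport along `γ⁻¹` from those along `γ`.
* §4 VHS DATA, along a loop `γ` at `s`: unipotence (integral and rational), quasi-unipotence and «mod `k`» triviality of the monodromy pass from
  `D₁, D₂` (resp. `D`) to `D₁ ⊗ D₂`, `D^∨`, `Hom(D₁, D₂)`, `D₁ ⊕ D₂`, `D(j)`, `ℤ_S(j)` (trivial monodromy), `D^{⊗m}`, `T^{a,b} D`.
* §5 **CDK's sentence for the tensor constructions**: if the integral monodromy of `D` along `γ` is `≡ 1 (mod k)`, `k ≥ 3`, and the monodromy of `D`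
  along `γ` is quasi-unipotent, then the monodromy of `D^{⊗m}`, of `T^{a,b} D`, of `D^∨` and of `D(j)` along `γ` is UNIPOTENT
  (`isNilpotent_tensorPow_V_transport_sub_one_of_level`, …) — no separate monodromy theorem for the constructions is needed.
* §6 **one finite-index subgroup of `π₁(S, s)` for all of them** (`exists_finiteIndex_forall_isNilpotent_tensorConstructions_sub_one`; for `D₁ ⊗ D₂` and
  `Hom(D₁, D₂)` the intersection of the two level-`3` subgroups).

## References

* [CattaniDeligneKaplan1995] E. Cattani, P. Deligne, A. Kaplan, *On the locus of Hodge classes*, J. Amer. Math. Soc. 8 (1995), «Proof of 1.5 ⟹ 1.1» (p. 485).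
* [Borel1991] A. Borel, *Linear Algebraic Groups*, 2nd ed., GTM 126, Springer 1991, I.4 (4.2, 4.4).
* [Schmid1973] W. Schmid, *Variation of Hodge structure: the singularities of the period mapping*, Invent. Math. 22 (1973), §4, (4.5).
* [Deligne1970] P. Deligne, *Équations différentielles à points singuliers réguliers*, LNM 163 (1970), I.1.
-/

noncomputable section

open scoped TensorProduct

namespace Literature.AlgebraicGeometry.Motives

/-! ## §1 Rings: quasi-unipotent products, inverses -/

section Ring

variable {A : Type*} [Ring A]

/-- **`(ab)^{mn} − 1` is nilpotent if `a^m − 1` and `b^n − 1` are and `a`, `b` commute** (quasi-unipotents, common exponent `mn`; products and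
powers of commuting unipotents are unipotent — the tree's `Literature.LinearAlgebra.isNilpotent_mul_sub_one_of_commute`, `isNilpotent_pow_sub_one`).
[cite: Borel1991, I.4 (4.2, 4.4)] [cite: Schmid1973, §4, (4.5)] -/
theorem isNilpotent_mul_pow_sub_one_of_commute {a b : A} (hab : Commute a b) {m n : ℕ} (ha : IsNilpotent (a ^ m - 1)) (hb : IsNilpotent (b ^ n - 1)) :
    IsNilpotent ((a * b) ^ (m * n) - 1) := by
  rw [hab.mul_pow, pow_mul, pow_mul' b m n]
  exact Literature.LinearAlgebra.isNilpotent_mul_sub_one_of_commute ((hab.pow_pow m n).pow_pow n m)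
    (Literature.LinearAlgebra.isNilpotent_pow_sub_one ha n) (Literature.LinearAlgebra.isNilpotent_pow_sub_one hb m)

/-- **If `ab = ba = 1` and `a − 1` is nilpotent then `b − 1` is nilpotent** (`b − 1 = −b(a − 1)`; the tree's `isNilpotent_units_inv_sub_one` is the
form for units). [cite: Borel1991, I.4 (4.2, 4.4)] -/
theorem isNilpotent_sub_one_of_mul_eq_one {a b : A} (hab : a * b = 1) (hba : b * a = 1) (ha : IsNilpotent (a - 1)) : IsNilpotent (b - 1) := by
  have hcomm : Commute b (a - 1) := (show Commute b a from hba.trans hab.symm).sub_right (Commute.one_right b)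
  have h : b - 1 = -(b * (a - 1)) := by rw [mul_sub, mul_one, hba, neg_sub]
  rw [h]
  exact (hcomm.isNilpotent_mul_left ha).neg

end Ring

/-! ## §2 Linear maps: quasi-unipotent `⊗`, `∨`; `⊕` over a commutative ring; level structures -/

section Linear

variable {R : Type*} [CommRing R] {M N : Type*} [AddCommGroup M] [Module R M] [AddCommGroup N] [Module R N]

/-- **Quasi-unipotent form of the tree's `isNilpotent_tensorProductMap_sub_one`**: `(T₁ ⊗ T₂)^a − 1` is nilpotent if `T₁^a − 1` and `T₂^a − 1` are
(`(T₁ ⊗ T₂)^a = T₁^a ⊗ T₂^a`). [cite: Schmid1973, §4, (4.5)] [cite: Deligne1970, I.1] -/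
theorem isNilpotent_map_pow_sub_one {f : Module.End R M} {g : Module.End R N} (a : ℕ) (hf : IsNilpotent (f ^ a - 1)) (hg : IsNilpotent (g ^ a - 1)) :
    IsNilpotent (TensorProduct.map f g ^ a - 1) := by
  rw [TensorProduct.map_pow]
  exact Literature.LinearAlgebra.isNilpotent_tensorProductMap_sub_one hf hg

/-- `(T^∨)^n = (T^n)^∨` over a commutative ring. [folklore] -/
private theorem dualMap_pow_eq (f : Module.End R M) (n : ℕ) : f.dualMap ^ n = (f ^ n).dualMap := by
  induction n with
  | zero => rw [pow_zero, pow_zero]; exact LinearMap.dualMap_id.symm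
  | succ n ih => rw [pow_succ, ih, pow_succ', Module.End.mul_eq_comp, Module.End.mul_eq_comp, LinearMap.dualMap_comp_dualMap]

/-- **Quasi-unipotent form of the tree's `isNilpotent_dualMap_sub_one`**: `(T^∨)^a − 1` is nilpotent if `T^a − 1` is. [cite: Schmid1973, §4, (4.5)]
[cite: Deligne1970, I.1] -/
theorem isNilpotent_dualMap_pow_sub_one {f : Module.End R M} (a : ℕ) (hf : IsNilpotent (f ^ a - 1)) : IsNilpotent (f.dualMap ^ a - 1) := by
  rw [dualMap_pow_eq]
  exact Literature.LinearAlgebra.isNilpotent_dualMap_sub_one hf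

/-- `(T₁ ⊕ T₂)^n = T₁^n ⊕ T₂^n`. [cite: Deligne1970, I.1] -/
theorem prodMap_pow (f : Module.End R M) (g : Module.End R N) (n : ℕ) : (f.prodMap g) ^ n = (f ^ n).prodMap (g ^ n) := by
  induction n with
  | zero => rw [pow_zero, pow_zero, pow_zero, LinearMap.prodMap_one]
  | succ n ih => rw [pow_succ, ih, pow_succ, pow_succ, LinearMap.prodMap_mul]

/-- **`T₁ ⊕ T₂ − 1` is nilpotent if `T₁ − 1`, `T₂ − 1` are**, over any commutative ring (the tree's `Literature.LinearAlgebra.isNilpotent_prodMap_sub_one`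
is the field case). [cite: Borel1991, I.4 (4.2, 4.4)] [cite: Deligne1970, I.1] -/
theorem isNilpotent_prodMap_sub_one {f : Module.End R M} {g : Module.End R N} (hf : IsNilpotent (f - 1)) (hg : IsNilpotent (g - 1)) :
    IsNilpotent (f.prodMap g - 1) := by
  obtain ⟨m, hm⟩ := hf
  obtain ⟨n, hn⟩ := hg
  have h1 : f.prodMap g - 1 = (f - 1).prodMap (g - 1) := LinearMap.ext fun _ => rfl
  refine ⟨m + n, ?_⟩
  rw [h1, prodMap_pow, pow_eq_zero_of_le (Nat.le_add_right m n) hm, pow_eq_zero_of_le (Nat.le_add_left n m) hn, LinearMap.prodMap_zero]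

/-- Quasi-unipotent form for `⊕`. [cite: Schmid1973, §4, (4.5)] [cite: Deligne1970, I.1] -/
theorem isNilpotent_prodMap_pow_sub_one {f : Module.End R M} {g : Module.End R N} (a : ℕ) (hf : IsNilpotent (f ^ a - 1)) (hg : IsNilpotent (g ^ a - 1)) :
    IsNilpotent (f.prodMap g ^ a - 1) := by
  rw [prodMap_pow]
  exact isNilpotent_prodMap_sub_one hf hg

/-- **«`≡ 1 (mod c)`» is inherited by `T₁ ⊗ T₂`**: if `T₁ u − u ∈ c·M` and `T₂ v − v ∈ c·N` pointwise, then `(T₁ ⊗ T₂) z − z ∈ c·(M ⊗ N)`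
(`T₁u ⊗ T₂v − u ⊗ v = (T₁u − u) ⊗ T₂v + u ⊗ (T₂v − v)`). [cite: CattaniDeligneKaplan1995, «Proof of 1.5 ⟹ 1.1» (p. 485)] [cite: Deligne1970, I.1] -/
theorem forall_exists_map_sub_eq_smul {f : Module.End R M} {g : Module.End R N} (c : R) (hf : ∀ m : M, ∃ m' : M, f m - m = c • m')
    (hg : ∀ n : N, ∃ n' : N, g n - n = c • n') : ∀ z : M ⊗[R] N, ∃ z' : M ⊗[R] N, TensorProduct.map f g z - z = c • z' := by
  intro z
  induction z using TensorProduct.induction_on with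
  | zero => exact ⟨0, by rw [map_zero, sub_zero, smul_zero]⟩
  | tmul m n =>
    obtain ⟨m', hm'⟩ := hf m
    obtain ⟨n', hn'⟩ := hg n
    refine ⟨m' ⊗ₜ[R] g n + m ⊗ₜ[R] n', ?_⟩
    rw [TensorProduct.map_tmul, smul_add, TensorProduct.smul_tmul', ← TensorProduct.tmul_smul, ← hm', ← hn', TensorProduct.sub_tmul,
      TensorProduct.tmul_sub, sub_add_sub_cancel]
  | add x y hx hy =>
    obtain ⟨x', hx'⟩ := hx
    obtain ⟨y', hy'⟩ := hy
    exact ⟨x' + y', by rw [map_add, add_sub_add_comm, hx', hy', smul_add]⟩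

/-- The same with `c : ℕ`. [cite: CattaniDeligneKaplan1995, «Proof of 1.5 ⟹ 1.1» (p. 485)] -/
theorem forall_exists_map_sub_eq_nsmul {f : Module.End R M} {g : Module.End R N} (c : ℕ) (hf : ∀ m : M, ∃ m' : M, f m - m = c • m')
    (hg : ∀ n : N, ∃ n' : N, g n - n = c • n') : ∀ z : M ⊗[R] N, ∃ z' : M ⊗[R] N, TensorProduct.map f g z - z = c • z' := fun z => by
  obtain ⟨z', hz'⟩ := forall_exists_map_sub_eq_smul (c : R) (fun m => (hf m).imp fun m' h => h.trans (Nat.cast_smul_eq_nsmul R c m').symm)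
    (fun n => (hg n).imp fun n' h => h.trans (Nat.cast_smul_eq_nsmul R c n').symm) z
  exact ⟨z', hz'.trans (Nat.cast_smul_eq_nsmul R c z')⟩

/-- **«`≡ 1 (mod c)`» is inherited by `T₁ ⊕ T₂`** (any scalars acting on both). [cite: CattaniDeligneKaplan1995, «Proof of 1.5 ⟹ 1.1» (p. 485)] [cite: Deligne1970, I.1] -/
theorem forall_exists_prodMap_sub_eq_smul {T : Type*} [SMul T M] [SMul T N] {f : Module.End R M} {g : Module.End R N} (c : T)
    (hf : ∀ m : M, ∃ m' : M, f m - m = c • m') (hg : ∀ n : N, ∃ n' : N, g n - n = c • n') :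
    ∀ x : M × N, ∃ x' : M × N, f.prodMap g x - x = c • x' := fun x => by
  obtain ⟨m', hm'⟩ := hf x.1
  obtain ⟨n', hn'⟩ := hg x.2
  exact ⟨(m', n'), Prod.ext hm' hn'⟩

/-- **On a free module, «`T ≡ 1 (mod c)` pointwise» means `T − 1 = c·B` for a linear `B`** (define `B` on a basis). [cite: Borel1969, §17.1]
[cite: CattaniDeligneKaplan1995, «Proof of 1.5 ⟹ 1.1» (p. 485)] -/
theorem exists_sub_one_eq_smul_of_forall [Module.Free R M] {f : Module.End R M} (c : R) (hf : ∀ m : M, ∃ m' : M, f m - m = c • m') :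
    ∃ B : Module.End R M, f - 1 = c • B := by
  let b := Module.Free.chooseBasis R M
  refine ⟨b.constr R fun i => Classical.choose (hf (b i)), b.ext fun i => ?_⟩
  rw [LinearMap.smul_apply, Module.Basis.constr_basis]
  exact Classical.choose_spec (hf (b i))

/-- **«`≡ 1 (mod c)`» is inherited by `T^∨` on a free module** (`T^∨ − 1 = (T − 1)^∨ = c·B^∨`). [cite: CattaniDeligneKaplan1995, «Proof of 1.5 ⟹ 1.1» (p. 485)]
[cite: Deligne1970, I.1] -/
theorem forall_exists_dualMap_sub_eq_smul [Module.Free R M] {f : Module.End R M} (c : R) (hf : ∀ m : M, ∃ m' : M, f m - m = c • m') :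
    ∀ φ : Module.Dual R M, ∃ φ' : Module.Dual R M, f.dualMap φ - φ = c • φ' := by
  obtain ⟨B, hB⟩ := exists_sub_one_eq_smul_of_forall c hf
  intro φ
  refine ⟨B.dualMap φ, LinearMap.ext fun m => ?_⟩
  have hm : f m - m = c • B m := LinearMap.congr_fun hB m
  show φ (f m) - φ m = c • φ (B m)
  rw [← map_sub, hm, map_smul]

/-- The same with `c : ℕ`. [cite: CattaniDeligneKaplan1995, «Proof of 1.5 ⟹ 1.1» (p. 485)] -/
theorem forall_exists_dualMap_sub_eq_nsmul [Module.Free R M] {f : Module.End R M} (c : ℕ) (hf : ∀ m : M, ∃ m' : M, f m - m = c • m') :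
    ∀ φ : Module.Dual R M, ∃ φ' : Module.Dual R M, f.dualMap φ - φ = c • φ' := fun φ => by
  obtain ⟨φ', hφ'⟩ := forall_exists_dualMap_sub_eq_smul (c : R) (fun m => (hf m).imp fun m' h => h.trans (Nat.cast_smul_eq_nsmul R c m').symm) φ
  exact ⟨φ', hφ'.trans (Nat.cast_smul_eq_nsmul R c φ')⟩

end Linear

/-! ## §3 Local systems: the transport along `γ⁻¹` -/

namespace LocalSystem

universe u

variable {R : Type u} [CommRing R] {S : Type u} [TopologicalSpace S] (V : LocalSystem R S)

/-- Along a loop, **the monodromy along `γ⁻¹` is unipotent iff the monodromy along `γ` is** (they are mutually inverse). [cite: Deligne1970, I.1.1]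
[cite: Borel1991, I.4 (4.2, 4.4)] -/
theorem isNilpotent_transport_symm_sub_one_iff {s : S} (γ : Path.Homotopic.Quotient s s) :
    IsNilpotent (V.transport γ.symm - 1) ↔ IsNilpotent (V.transport γ - 1) := by
  have h₁ : V.transport γ * V.transport γ.symm = 1 := LinearMap.ext (V.transport_apply_transport_symm γ)
  have h₂ : V.transport γ.symm * V.transport γ = 1 := LinearMap.ext (V.transport_symm_apply_transport γ)
  exact ⟨isNilpotent_sub_one_of_mul_eq_one h₂ h₁, isNilpotent_sub_one_of_mul_eq_one h₁ h₂⟩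

/-- Along a loop, **«`≡ 1 (mod c)`» along `γ⁻¹` follows from «`≡ 1 (mod c)`» along `γ`** (`γ⁻¹_* u − u = −γ⁻¹_*(γ_* v − v)` with `u = γ_* v`…;
here `v = γ⁻¹_* u`). [cite: CattaniDeligneKaplan1995, «Proof of 1.5 ⟹ 1.1» (p. 485)] [cite: Deligne1970, I.1.1] -/
theorem forall_exists_transport_symm_sub_eq_smul {s : S} (γ : Path.Homotopic.Quotient s s) {T : Type*} [Monoid T] [DistribMulAction T (V.fiber s)]
    (c : T) (h : ∀ u : V.fiber s, ∃ u' : V.fiber s, V.transport γ u - u = c • u') :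
    ∀ u : V.fiber s, ∃ u' : V.fiber s, V.transport γ.symm u - u = c • u' := fun u => by
  obtain ⟨v', hv'⟩ := h (V.transport γ.symm u)
  rw [V.transport_apply_transport_symm] at hv'
  exact ⟨-v', by rw [smul_neg, ← hv', neg_sub]⟩

end LocalSystem

/-! ## §4 VHS data: the tensor constructions inherit (quasi-)unipotent monodromy and level structures -/

namespace VHSData

variable {S : Type} [TopologicalSpace S] {k k₁ k₂ : ℤ}

section Tensor

variable (D₁ : VHSData S k₁) (D₂ : VHSData S k₂) {s : S} (γ : Path.Homotopic.Quotient s s)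

/-- **`D₁ ⊗ D₂`: unipotent integral monodromy from that of the factors** (`γ_* = γ_* ⊗ γ_*`). [cite: Deligne1970, I.1] [cite: Borel1991, I.4 (4.2, 4.4)] -/
theorem isNilpotent_tensor_VZ_transport_sub_one (h₁ : IsNilpotent (D₁.VZ.transport γ - 1)) (h₂ : IsNilpotent (D₂.VZ.transport γ - 1)) :
    IsNilpotent ((D₁.tensor D₂).VZ.transport γ - 1) :=
  Literature.LinearAlgebra.isNilpotent_tensorProductMap_sub_one h₁ h₂

/-- `D₁ ⊗ D₂`: unipotent rational monodromy from that of the factors. [cite: Deligne1970, I.1] [cite: Borel1991, I.4 (4.2, 4.4)] -/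
theorem isNilpotent_tensor_V_transport_sub_one (h₁ : IsNilpotent (D₁.V.transport γ - 1)) (h₂ : IsNilpotent (D₂.V.transport γ - 1)) :
    IsNilpotent ((D₁.tensor D₂).V.transport γ - 1) :=
  Literature.LinearAlgebra.isNilpotent_tensorProductMap_sub_one h₁ h₂

/-- `D₁ ⊗ D₂`: quasi-unipotent monodromy (common exponent) from that of the factors. [cite: Schmid1973, §4, (4.5)] [cite: Deligne1970, I.1] -/
theorem isNilpotent_tensor_V_transport_pow_sub_one (a : ℕ) (h₁ : IsNilpotent (D₁.V.transport γ ^ a - 1)) (h₂ : IsNilpotent (D₂.V.transport γ ^ a - 1)) :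
    IsNilpotent ((D₁.tensor D₂).V.transport γ ^ a - 1) :=
  isNilpotent_map_pow_sub_one a h₁ h₂

/-- **`D₁ ⊗ D₂`: «monodromy `≡ 1 (mod k)`» from that of the factors.** [cite: CattaniDeligneKaplan1995, «Proof of 1.5 ⟹ 1.1» (p. 485)] [cite: Deligne1970, I.1] -/
theorem forall_exists_tensor_VZ_transport_sub_eq_smul (c : ℕ) (h₁ : ∀ u : D₁.VZ.fiber s, ∃ u' : D₁.VZ.fiber s, D₁.VZ.transport γ u - u = c • u')
    (h₂ : ∀ u : D₂.VZ.fiber s, ∃ u' : D₂.VZ.fiber s, D₂.VZ.transport γ u - u = c • u') :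
    ∀ z : (D₁.tensor D₂).VZ.fiber s, ∃ z' : (D₁.tensor D₂).VZ.fiber s, (D₁.tensor D₂).VZ.transport γ z - z = c • z' :=
  forall_exists_map_sub_eq_nsmul c h₁ h₂

end Tensor

section Dual

variable (D : VHSData S k) {s : S} (γ : Path.Homotopic.Quotient s s)

/-- **`D^∨`: unipotent integral monodromy from that of `D`** (`γ_*` on `V^∨` is `((γ⁻¹)_*)^∨`). [cite: Deligne1970, I.1] [cite: Borel1991, I.4 (4.2, 4.4)] -/
theorem isNilpotent_dual_VZ_transport_sub_one (h : IsNilpotent (D.VZ.transport γ - 1)) : IsNilpotent (D.dual.VZ.transport γ - 1) :=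
  Literature.LinearAlgebra.isNilpotent_dualMap_sub_one ((D.VZ.isNilpotent_transport_symm_sub_one_iff γ).2 h)

/-- `D^∨`: unipotent rational monodromy from that of `D`. [cite: Deligne1970, I.1] [cite: Borel1991, I.4 (4.2, 4.4)] -/
theorem isNilpotent_dual_V_transport_sub_one (h : IsNilpotent (D.V.transport γ - 1)) : IsNilpotent (D.dual.V.transport γ - 1) :=
  Literature.LinearAlgebra.isNilpotent_dualMap_sub_one ((D.V.isNilpotent_transport_symm_sub_one_iff γ).2 h)

/-- **`D^∨`: «monodromy `≡ 1 (mod k)`» from that of `D`** (`V_ℤ,s` is free: `D.free s`). [cite: CattaniDeligneKaplan1995, «Proof of 1.5 ⟹ 1.1» (p. 485)]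
[cite: Deligne1970, I.1] -/
theorem forall_exists_dual_VZ_transport_sub_eq_smul (c : ℕ) (h : ∀ u : D.VZ.fiber s, ∃ u' : D.VZ.fiber s, D.VZ.transport γ u - u = c • u') :
    ∀ φ : D.dual.VZ.fiber s, ∃ φ' : D.dual.VZ.fiber s, D.dual.VZ.transport γ φ - φ = c • φ' := by
  haveI := D.free s
  exact forall_exists_dualMap_sub_eq_nsmul c (D.VZ.forall_exists_transport_symm_sub_eq_smul γ c h)

end Dual

section Hom

variable (D₁ D₂ : VHSData S k) {s : S} (γ : Path.Homotopic.Quotient s s)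

/-- **`Hom(D₁, D₂) = D₁^∨ ⊗ D₂`: unipotent integral monodromy from that of `D₁`, `D₂`.** [cite: Deligne1970, I.1] [cite: Borel1991, I.4 (4.2, 4.4)] -/
theorem isNilpotent_hom_VZ_transport_sub_one (h₁ : IsNilpotent (D₁.VZ.transport γ - 1)) (h₂ : IsNilpotent (D₂.VZ.transport γ - 1)) :
    IsNilpotent ((D₁.hom D₂).VZ.transport γ - 1) :=
  Literature.LinearAlgebra.isNilpotent_tensorProductMap_sub_one (D₁.isNilpotent_dual_VZ_transport_sub_one γ h₁) h₂

/-- `Hom(D₁, D₂)`: unipotent rational monodromy from that of `D₁`, `D₂`. [cite: Deligne1970, I.1] [cite: Borel1991, I.4 (4.2, 4.4)] -/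
theorem isNilpotent_hom_V_transport_sub_one (h₁ : IsNilpotent (D₁.V.transport γ - 1)) (h₂ : IsNilpotent (D₂.V.transport γ - 1)) :
    IsNilpotent ((D₁.hom D₂).V.transport γ - 1) :=
  Literature.LinearAlgebra.isNilpotent_tensorProductMap_sub_one (D₁.isNilpotent_dual_V_transport_sub_one γ h₁) h₂

end Hom

section Prod

variable (D₁ D₂ : VHSData S k) {s : S} (γ : Path.Homotopic.Quotient s s)

/-- **`D₁ ⊕ D₂`: unipotent integral monodromy from that of the summands.** [cite: Deligne1970, I.1] [cite: Borel1991, I.4 (4.2, 4.4)] -/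
theorem isNilpotent_prod_VZ_transport_sub_one (h₁ : IsNilpotent (D₁.VZ.transport γ - 1)) (h₂ : IsNilpotent (D₂.VZ.transport γ - 1)) :
    IsNilpotent ((D₁.prod D₂).VZ.transport γ - 1) :=
  isNilpotent_prodMap_sub_one h₁ h₂

/-- `D₁ ⊕ D₂`: unipotent rational monodromy from that of the summands. [cite: Deligne1970, I.1] [cite: Borel1991, I.4 (4.2, 4.4)] -/
theorem isNilpotent_prod_V_transport_sub_one (h₁ : IsNilpotent (D₁.V.transport γ - 1)) (h₂ : IsNilpotent (D₂.V.transport γ - 1)) :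
    IsNilpotent ((D₁.prod D₂).V.transport γ - 1) :=
  isNilpotent_prodMap_sub_one h₁ h₂

/-- `D₁ ⊕ D₂`: quasi-unipotent monodromy (common exponent) from that of the summands. [cite: Schmid1973, §4, (4.5)] [cite: Deligne1970, I.1] -/
theorem isNilpotent_prod_V_transport_pow_sub_one (a : ℕ) (h₁ : IsNilpotent (D₁.V.transport γ ^ a - 1)) (h₂ : IsNilpotent (D₂.V.transport γ ^ a - 1)) :
    IsNilpotent ((D₁.prod D₂).V.transport γ ^ a - 1) :=
  isNilpotent_prodMap_pow_sub_one a h₁ h₂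

/-- **`D₁ ⊕ D₂`: «monodromy `≡ 1 (mod k)`» from that of the summands.** [cite: CattaniDeligneKaplan1995, «Proof of 1.5 ⟹ 1.1» (p. 485)] [cite: Deligne1970, I.1] -/
theorem forall_exists_prod_VZ_transport_sub_eq_smul (c : ℕ) (h₁ : ∀ u : D₁.VZ.fiber s, ∃ u' : D₁.VZ.fiber s, D₁.VZ.transport γ u - u = c • u')
    (h₂ : ∀ u : D₂.VZ.fiber s, ∃ u' : D₂.VZ.fiber s, D₂.VZ.transport γ u - u = c • u') :
    ∀ x : (D₁.prod D₂).VZ.fiber s, ∃ x' : (D₁.prod D₂).VZ.fiber s, (D₁.prod D₂).VZ.transport γ x - x = c • x' := fun x => by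
  obtain ⟨m', hm'⟩ := h₁ x.1
  obtain ⟨n', hn'⟩ := h₂ x.2
  exact ⟨(m', n'), Prod.ext hm' hn'⟩

end Prod

section Twist

variable (D : VHSData S k) (j : ℤ) {s : S} (γ : Path.Homotopic.Quotient s s)

/-- `D(j)` has the monodromy of `D`. [cite: DeligneHodgeII1971, 2.1.14] [cite: Deligne1970, I.1] -/
theorem isNilpotent_tateTwist_VZ_transport_sub_one_iff : IsNilpotent ((D.tateTwist j).VZ.transport γ - 1) ↔ IsNilpotent (D.VZ.transport γ - 1) := Iff.rfl

/-- `D(j)` has the rational monodromy of `D`. [cite: DeligneHodgeII1971, 2.1.14] [cite: Deligne1970, I.1] -/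
theorem isNilpotent_tateTwist_V_transport_sub_one_iff : IsNilpotent ((D.tateTwist j).V.transport γ - 1) ↔ IsNilpotent (D.V.transport γ - 1) := Iff.rfl

/-- **`ℤ_S(j)` has trivial, in particular unipotent, monodromy.** [cite: Deligne1970, I.1] -/
theorem isNilpotent_tate_VZ_transport_sub_one : IsNilpotent ((tate S j).VZ.transport γ - 1) :=
  ⟨1, by rw [pow_one]; exact sub_eq_zero.2 rfl⟩

/-- `ℚ_S(j)`: trivial rational monodromy. [cite: Deligne1970, I.1] -/
theorem isNilpotent_tate_V_transport_sub_one : IsNilpotent ((tate S j).V.transport γ - 1) :=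
  ⟨1, by rw [pow_one]; exact sub_eq_zero.2 rfl⟩

/-- `ℤ_S(j)`: the monodromy is `≡ 1 (mod k)` for every `k` (it is the identity). [cite: Deligne1970, I.1] -/
theorem forall_exists_tate_VZ_transport_sub_eq_smul (c : ℕ) :
    ∀ u : (tate S j).VZ.fiber s, ∃ u' : (tate S j).VZ.fiber s, (tate S j).VZ.transport γ u - u = c • u' := fun u =>
  ⟨0, by rw [smul_zero]; exact sub_eq_zero.2 rfl⟩

end Twist

section TensorPow

variable (D : VHSData S k) {s : S} (γ : Path.Homotopic.Quotient s s)

/-- **`D^{⊗m}`: unipotent integral monodromy from that of `D`.** [cite: Deligne1970, I.1] [cite: Borel1991, I.4 (4.2, 4.4)] -/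
theorem isNilpotent_tensorPow_VZ_transport_sub_one (h : IsNilpotent (D.VZ.transport γ - 1)) (m : ℕ) :
    IsNilpotent ((D.tensorPow m).VZ.transport γ - 1) := by
  induction m with
  | zero => exact ⟨1, by rw [pow_one]; exact sub_eq_zero.2 rfl⟩
  | succ m ih => exact Literature.LinearAlgebra.isNilpotent_tensorProductMap_sub_one ih h

/-- `D^{⊗m}`: unipotent rational monodromy from that of `D`. [cite: Deligne1970, I.1] [cite: Borel1991, I.4 (4.2, 4.4)] -/
theorem isNilpotent_tensorPow_V_transport_sub_one (h : IsNilpotent (D.V.transport γ - 1)) (m : ℕ) :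
    IsNilpotent ((D.tensorPow m).V.transport γ - 1) := by
  induction m with
  | zero => exact ⟨1, by rw [pow_one]; exact sub_eq_zero.2 rfl⟩
  | succ m ih => exact Literature.LinearAlgebra.isNilpotent_tensorProductMap_sub_one ih h

/-- **`D^{⊗m}`: «monodromy `≡ 1 (mod k)`» from that of `D`.** [cite: CattaniDeligneKaplan1995, «Proof of 1.5 ⟹ 1.1» (p. 485)] [cite: Deligne1970, I.1] -/
theorem forall_exists_tensorPow_VZ_transport_sub_eq_smul (c : ℕ) (h : ∀ u : D.VZ.fiber s, ∃ u' : D.VZ.fiber s, D.VZ.transport γ u - u = c • u') (m : ℕ) :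
    ∀ z : (D.tensorPow m).VZ.fiber s, ∃ z' : (D.tensorPow m).VZ.fiber s, (D.tensorPow m).VZ.transport γ z - z = c • z' := by
  induction m with
  | zero => exact fun u => ⟨0, by rw [smul_zero]; exact sub_eq_zero.2 rfl⟩
  | succ m ih => exact (D.tensorPow m).forall_exists_tensor_VZ_transport_sub_eq_smul D γ c ih h

/-- **`T^{a,b} D = D^{⊗a} ⊗ (D^∨)^{⊗b}`: unipotent integral monodromy from that of `D`.** [cite: Deligne1970, I.1] [cite: Borel1991, I.4 (4.2, 4.4)] -/
theorem isNilpotent_tensorSpace_VZ_transport_sub_one (h : IsNilpotent (D.VZ.transport γ - 1)) (a b : ℕ) :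
    IsNilpotent ((D.tensorSpace a b).VZ.transport γ - 1) :=
  Literature.LinearAlgebra.isNilpotent_tensorProductMap_sub_one (D.isNilpotent_tensorPow_VZ_transport_sub_one γ h a)
    (D.dual.isNilpotent_tensorPow_VZ_transport_sub_one γ (D.isNilpotent_dual_VZ_transport_sub_one γ h) b)

/-- `T^{a,b} D`: unipotent rational monodromy from that of `D`. [cite: Deligne1970, I.1] [cite: Borel1991, I.4 (4.2, 4.4)] -/
theorem isNilpotent_tensorSpace_V_transport_sub_one (h : IsNilpotent (D.V.transport γ - 1)) (a b : ℕ) :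
    IsNilpotent ((D.tensorSpace a b).V.transport γ - 1) :=
  Literature.LinearAlgebra.isNilpotent_tensorProductMap_sub_one (D.isNilpotent_tensorPow_V_transport_sub_one γ h a)
    (D.dual.isNilpotent_tensorPow_V_transport_sub_one γ (D.isNilpotent_dual_V_transport_sub_one γ h) b)

/-- `T^{a,b} D`: «monodromy `≡ 1 (mod k)`» from that of `D`. [cite: CattaniDeligneKaplan1995, «Proof of 1.5 ⟹ 1.1» (p. 485)] [cite: Deligne1970, I.1] -/
theorem forall_exists_tensorSpace_VZ_transport_sub_eq_smul (c : ℕ) (h : ∀ u : D.VZ.fiber s, ∃ u' : D.VZ.fiber s, D.VZ.transport γ u - u = c • u')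
    (a b : ℕ) : ∀ z : (D.tensorSpace a b).VZ.fiber s, ∃ z' : (D.tensorSpace a b).VZ.fiber s, (D.tensorSpace a b).VZ.transport γ z - z = c • z' :=
  (D.tensorPow a).forall_exists_tensor_VZ_transport_sub_eq_smul (D.dual.tensorPow b) γ c (D.forall_exists_tensorPow_VZ_transport_sub_eq_smul γ c h a)
    (D.dual.forall_exists_tensorPow_VZ_transport_sub_eq_smul γ c (D.forall_exists_dual_VZ_transport_sub_eq_smul γ c h) b)

end TensorPow

/-! ## §5 «The local monodromy at infinity is unipotent» — for the tensor constructions, from the hypotheses on `D` alone -/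

section CDK

variable (D : VHSData S k) {s : S} (γ : Path.Homotopic.Quotient s s)

/-- **CDK's sentence for `D^{⊗m}`.**  If the integral monodromy of `D` along the loop `γ` is `≡ 1 (mod k)` with `k ≥ 3` and the monodromy of `D`
along `γ` is quasi-unipotent (`T^a − 1` nilpotent, `a ≥ 1`), then the monodromy of `D^{⊗m}` along `γ` is unipotent (that of `D` is, by
`isNilpotent_transport_sub_one_of_level`, and unipotence passes to tensor powers). [cite: CattaniDeligneKaplan1995, «Proof of 1.5 ⟹ 1.1» (p. 485)]
[cite: Borel1991, I.4 (4.2, 4.4)] -/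
theorem isNilpotent_tensorPow_V_transport_sub_one_of_level {c : ℕ} (hc : 3 ≤ c)
    (hlevel : ∀ u : D.VZ.fiber s, ∃ u' : D.VZ.fiber s, D.VZ.transport γ u - u = c • u') {a : ℕ} (ha : 0 < a)
    (hqu : IsNilpotent (D.V.transport γ ^ a - 1)) (m : ℕ) : IsNilpotent ((D.tensorPow m).V.transport γ - 1) :=
  D.isNilpotent_tensorPow_V_transport_sub_one γ (D.isNilpotent_transport_sub_one_of_level γ hc hlevel ha hqu) m

/-- **CDK's sentence for `T^{a,b} D`.** [cite: CattaniDeligneKaplan1995, «Proof of 1.5 ⟹ 1.1» (p. 485)] [cite: Borel1991, I.4 (4.2, 4.4)] -/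
theorem isNilpotent_tensorSpace_V_transport_sub_one_of_level {c : ℕ} (hc : 3 ≤ c)
    (hlevel : ∀ u : D.VZ.fiber s, ∃ u' : D.VZ.fiber s, D.VZ.transport γ u - u = c • u') {a : ℕ} (ha : 0 < a)
    (hqu : IsNilpotent (D.V.transport γ ^ a - 1)) (p q : ℕ) : IsNilpotent ((D.tensorSpace p q).V.transport γ - 1) :=
  D.isNilpotent_tensorSpace_V_transport_sub_one γ (D.isNilpotent_transport_sub_one_of_level γ hc hlevel ha hqu) p q

/-- **CDK's sentence for `D^∨`.** [cite: CattaniDeligneKaplan1995, «Proof of 1.5 ⟹ 1.1» (p. 485)] [cite: Borel1991, I.4 (4.2, 4.4)] -/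
theorem isNilpotent_dual_V_transport_sub_one_of_level {c : ℕ} (hc : 3 ≤ c)
    (hlevel : ∀ u : D.VZ.fiber s, ∃ u' : D.VZ.fiber s, D.VZ.transport γ u - u = c • u') {a : ℕ} (ha : 0 < a)
    (hqu : IsNilpotent (D.V.transport γ ^ a - 1)) : IsNilpotent (D.dual.V.transport γ - 1) :=
  D.isNilpotent_dual_V_transport_sub_one γ (D.isNilpotent_transport_sub_one_of_level γ hc hlevel ha hqu)

/-- **CDK's sentence for `D(j)`.** [cite: CattaniDeligneKaplan1995, «Proof of 1.5 ⟹ 1.1» (p. 485)] [cite: DeligneHodgeII1971, 2.1.14] -/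
theorem isNilpotent_tateTwist_V_transport_sub_one_of_level (j : ℤ) {c : ℕ} (hc : 3 ≤ c)
    (hlevel : ∀ u : D.VZ.fiber s, ∃ u' : D.VZ.fiber s, D.VZ.transport γ u - u = c • u') {a : ℕ} (ha : 0 < a)
    (hqu : IsNilpotent (D.V.transport γ ^ a - 1)) : IsNilpotent ((D.tateTwist j).V.transport γ - 1) :=
  D.isNilpotent_transport_sub_one_of_level γ hc hlevel ha hqu

end CDK

/-! ## §6 «Replace `S` by a finite étale covering»: ONE finite-index subgroup of `π₁(S, s)` for all the tensor constructions -/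

section Cover

variable (D : VHSData S k) (D₁ : VHSData S k₁) (D₂ : VHSData S k₂)

/-- **One subgroup for all tensor constructions of `D`.**  There is a finite-index subgroup `H ≤ π₁(S, s)` (the level-`3` subgroup of `D`,
`exists_finiteIndex_forall_level`) such that for every `γ ∈ H` along which the monodromy of `D` is quasi-unipotent, the monodromy along `γ` of
EVERY `D^{⊗m}`, every `T^{a,b} D`, of `D^∨` and of every `D(j)` is unipotent — the finite étale cover of CDK's «Proof of 1.5 ⟹ 1.1» chosen for `𝒱`
serves all its tensor constructions at once. [cite: CattaniDeligneKaplan1995, «Proof of 1.5 ⟹ 1.1» (p. 485)] [cite: Borel1991, I.4 (4.2, 4.4)] -/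
theorem exists_finiteIndex_forall_isNilpotent_tensorConstructions_sub_one (s : S) :
    ∃ H : Subgroup (FundamentalGroup S s), H.FiniteIndex ∧ ∀ γ ∈ H, ∀ a : ℕ, 0 < a → IsNilpotent (D.V.monodromyRep s γ ^ a - 1) →
      (∀ m : ℕ, IsNilpotent ((D.tensorPow m).V.monodromyRep s γ - 1)) ∧
        (∀ p q : ℕ, IsNilpotent ((D.tensorSpace p q).V.monodromyRep s γ - 1)) ∧
          IsNilpotent (D.dual.V.monodromyRep s γ - 1) ∧ ∀ j : ℤ, IsNilpotent ((D.tateTwist j).V.monodromyRep s γ - 1) := by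
  obtain ⟨H, hH, hlevel⟩ := D.exists_finiteIndex_forall_level s (k := 3) (by norm_num)
  refine ⟨H, hH, fun γ hγ a ha hqu => ?_⟩
  have hl : ∀ u : D.VZ.fiber s, ∃ u' : D.VZ.fiber s, D.VZ.transport (FundamentalGroup.toPath γ) u - u = 3 • u' := fun u => hlevel γ hγ u
  rw [LocalSystem.monodromyRep_apply] at hqu
  exact ⟨fun m => D.isNilpotent_tensorPow_V_transport_sub_one_of_level _ le_rfl hl ha hqu m,
    fun p q => D.isNilpotent_tensorSpace_V_transport_sub_one_of_level _ le_rfl hl ha hqu p q,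
    D.isNilpotent_dual_V_transport_sub_one_of_level _ le_rfl hl ha hqu, fun j => D.isNilpotent_tateTwist_V_transport_sub_one_of_level _ j le_rfl hl ha hqu⟩

/-- **One subgroup for `D₁ ⊗ D₂`** (the intersection of the level-`3` subgroups of `D₁` and `D₂`, of finite index): along every `γ` in it with
quasi-unipotent monodromies of `D₁` and `D₂`, the monodromy of `D₁ ⊗ D₂` is unipotent. [cite: CattaniDeligneKaplan1995, «Proof of 1.5 ⟹ 1.1» (p. 485)]
[cite: Borel1991, I.4 (4.2, 4.4)] -/
theorem exists_finiteIndex_forall_isNilpotent_tensor_sub_one (s : S) :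
    ∃ H : Subgroup (FundamentalGroup S s), H.FiniteIndex ∧ ∀ γ ∈ H, ∀ a₁ : ℕ, 0 < a₁ → IsNilpotent (D₁.V.monodromyRep s γ ^ a₁ - 1) →
      ∀ a₂ : ℕ, 0 < a₂ → IsNilpotent (D₂.V.monodromyRep s γ ^ a₂ - 1) → IsNilpotent ((D₁.tensor D₂).V.monodromyRep s γ - 1) := by
  obtain ⟨H₁, hH₁, hlevel₁⟩ := D₁.exists_finiteIndex_forall_level s (k := 3) (by norm_num)
  obtain ⟨H₂, hH₂, hlevel₂⟩ := D₂.exists_finiteIndex_forall_level s (k := 3) (by norm_num)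
  haveI := hH₁
  haveI := hH₂
  refine ⟨H₁ ⊓ H₂, inferInstance, fun γ hγ a₁ ha₁ hqu₁ a₂ ha₂ hqu₂ => ?_⟩
  rw [LocalSystem.monodromyRep_apply] at hqu₁ hqu₂
  exact D₁.isNilpotent_tensor_V_transport_sub_one D₂ _
    (D₁.isNilpotent_transport_sub_one_of_level _ le_rfl (fun u => hlevel₁ γ (Subgroup.mem_inf.1 hγ).1 u) ha₁ hqu₁)
    (D₂.isNilpotent_transport_sub_one_of_level _ le_rfl (fun u => hlevel₂ γ (Subgroup.mem_inf.1 hγ).2 u) ha₂ hqu₂)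

/-- **One subgroup for `Hom(D₁, D₂)`** (same weight). [cite: CattaniDeligneKaplan1995, «Proof of 1.5 ⟹ 1.1» (p. 485)] [cite: Borel1991, I.4 (4.2, 4.4)] -/
theorem exists_finiteIndex_forall_isNilpotent_hom_sub_one (D₁ D₂ : VHSData S k) (s : S) :
    ∃ H : Subgroup (FundamentalGroup S s), H.FiniteIndex ∧ ∀ γ ∈ H, ∀ a₁ : ℕ, 0 < a₁ → IsNilpotent (D₁.V.monodromyRep s γ ^ a₁ - 1) →
      ∀ a₂ : ℕ, 0 < a₂ → IsNilpotent (D₂.V.monodromyRep s γ ^ a₂ - 1) → IsNilpotent ((D₁.hom D₂).V.monodromyRep s γ - 1) := by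
  obtain ⟨H₁, hH₁, hlevel₁⟩ := D₁.exists_finiteIndex_forall_level s (k := 3) (by norm_num)
  obtain ⟨H₂, hH₂, hlevel₂⟩ := D₂.exists_finiteIndex_forall_level s (k := 3) (by norm_num)
  haveI := hH₁
  haveI := hH₂
  refine ⟨H₁ ⊓ H₂, inferInstance, fun γ hγ a₁ ha₁ hqu₁ a₂ ha₂ hqu₂ => ?_⟩
  rw [LocalSystem.monodromyRep_apply] at hqu₁ hqu₂
  exact D₁.isNilpotent_hom_V_transport_sub_one D₂ _
    (D₁.isNilpotent_transport_sub_one_of_level _ le_rfl (fun u => hlevel₁ γ (Subgroup.mem_inf.1 hγ).1 u) ha₁ hqu₁)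
    (D₂.isNilpotent_transport_sub_one_of_level _ le_rfl (fun u => hlevel₂ γ (Subgroup.mem_inf.1 hγ).2 u) ha₂ hqu₂)

end Cover

end VHSData

end Literature.AlgebraicGeometry.Motives

end
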